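import Summits.QuantumAdvantage.AdviceFreeQNC0.UnionBoundLift
import Summits.QuantumAdvantage.AdviceFreeQNC0.EliminationLogDegree
import Summits.QuantumAdvantage.AdviceFreeQNC0.CosetBound
import Summits.QuantumAdvantage.AdviceFreeQNC0.WalshModThree
import HarnessLib

/-!
# Cell qa-qnc0 (rung F-S1, route RingFrame, crux α, line `tensor`): the lift-cost identity
# `hw (X ⊕ W) = 2^{L−1} · #colDiff X W` for matrices with linear columns (qn-p2 ask T-a (i), `LiftCostEq`)

Planner qa-qnc0-p2's ROUND-4 PROP 1.1 / `line/Sketch4.lean` §1 `LiftCostEq` (ask T-a (i), marked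
"now load-bearing" in `S1-REFUTED.md` §G for the refutations N-1/N-2: it is the exact cov formula
`min_W hw(X ⊕ W) = 2^{L−1}·|Z|`): if `X` and `W` both have LINEAR columns (`LinCols`, p464335
`UnionBoundLift.lean`), then so does `X ⊕ W` (`linCols_xorM`), a non-zero linear functional on `𝔽₂^L`
takes the value `1` exactly `2^{L−1}` times (`card_filter_col_eq_of_linCols`: flip one support bit,
`CubeChar.flipBit` of `WalshModThree.lean` — an involution exchanging the `1`s and the `0`s of the
column), hence, counting `hw` column by column (`hw_eq_sum_cols`, `CosetBound.lean`),
`hw (xorM X W) = 2^{L−1} · #(colDiff X W)` (`liftCostEq : LiftCostEq`, statement VERBATIM from Sketch4;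
the hypothesis `0 < L` of the planner's form is not needed and is kept only in the `Prop`).
WHAT THIS IS NOT: nothing on `LiftOneStrict`/`UnionBound` themselves (REFUTED on paper by qn-p2 g4,
S1-REFUTED.md THEOREM A — the kernel refutations N-1/N-2 are separate asks), nothing on α. [folklore]
-/

namespace Summit.QuantumAdvantage.AdviceFreeQNC0

open Finset
open Literature.Computability.MetaComplexity Literature.Computability.MetaComplexity.Smolensky

variable {L L' : ℕ}

/-- **T-a (i)** (qn-p2 `Sketch4.LiftCostEq`, verbatim): for matrices with linear columns,
`hw (X ⊕ W) = 2^{L-1} · #(columns where they differ)`. -/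
def LiftCostEq : Prop :=
  ∀ (L L' : ℕ) (X W : (Fin L → Bool) → (Fin L' → Bool) → Bool), 0 < L → LinCols X → LinCols W →
    hw (xorM X W) = 2 ^ (L - 1) * (colDiff X W).card

/-! ### Linear columns are closed under `⊕` -/

/-- `X ⊕ W` has linear columns if `X` and `W` do. [folklore] -/
theorem linCols_xorM {X W : (Fin L → Bool) → (Fin L' → Bool) → Bool} (hX : LinCols X)
    (hW : LinCols W) : LinCols (xorM X W) := by
  refine ⟨fun v => ?_, fun v => ?_⟩
  · exact hasDeg_xor (hX.1 v) (hW.1 v)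
  · show xor (X (fun _ => false) v) (W (fun _ => false) v) = false
    rw [hX.2 v, hW.2 v]; rfl

/-! ### A non-zero linear column has exactly `2^{L-1}` ones -/

/-- `𝔽₂`-indicator of the row with its `i₀`-th bit flipped (`CubeChar.flipBit`, `WalshModThree.lean`):
only the `i₀`-th bit changes, by `+1`. [folklore] -/
theorem indicator_flipBit (i₀ : Fin L) (u : Fin L → Bool) (i : Fin L) :
    (if CubeChar.flipBit i₀ u i = true then (1 : ZMod 2) else 0) =
      (if u i = true then (1 : ZMod 2) else 0) + if i = i₀ then 1 else 0 := by
  unfold CubeChar.flipBit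
  by_cases hi : i = i₀
  · subst hi
    simp only [Function.update_self, if_true]
    cases u i <;> decide
  · simp [hi]

/-- A linear column flips under `flipBit i₀` whenever its value on the basis row `e_{i₀}` is `1`.
[folklore] -/
theorem apply_flipBit_ne {X : (Fin L → Bool) → (Fin L' → Bool) → Bool} (hX : LinCols X)
    (v : Fin L' → Bool) {i₀ : Fin L} (hi₀ : X (basisRow i₀) v = true) (u : Fin L → Bool) :
    X (CubeChar.flipBit i₀ u) v ≠ X u v := by
  intro heq
  have h1 := apply_eq_sum_basis_of_linCols hX (CubeChar.flipBit i₀ u) v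
  have h2 := apply_eq_sum_basis_of_linCols hX u v
  -- rewrite the flipped sum
  have hsum : (∑ i, (if CubeChar.flipBit i₀ u i = true then (1 : ZMod 2) else 0) *
      (if X (basisRow i) v = true then (1 : ZMod 2) else 0)) =
      (∑ i, (if u i = true then (1 : ZMod 2) else 0) *
        (if X (basisRow i) v = true then (1 : ZMod 2) else 0)) + 1 := by
    have e : ∀ i, (if CubeChar.flipBit i₀ u i = true then (1 : ZMod 2) else 0) *
        (if X (basisRow i) v = true then (1 : ZMod 2) else 0) =
        (if u i = true then (1 : ZMod 2) else 0) * (if X (basisRow i) v = true then (1 : ZMod 2) else 0) +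
          (if i = i₀ then 1 else 0) := by
      intro i
      rw [indicator_flipBit i₀ u i, add_mul]
      congr 1
      by_cases hi : i = i₀
      · subst hi; simp [hi₀]
      · simp [hi]
    rw [Finset.sum_congr rfl fun i _ => e i, Finset.sum_add_distrib, Finset.sum_ite_eq' univ i₀,
      if_pos (Finset.mem_univ _)]
  rw [hsum, ← h2, heq] at h1
  -- `a = a + 1` in `𝔽₂` is absurd
  have : (1 : ZMod 2) = 0 := by
    have h1' := h1
    generalize (if X u v = true then (1 : ZMod 2) else 0) = a at h1'
    revert h1'; revert a; decide
  exact absurd this (by decide)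

/-- **A non-zero linear column has exactly `2^{L−1}` ones.** [folklore] -/
theorem card_filter_col_eq_of_linCols {X : (Fin L → Bool) → (Fin L' → Bool) → Bool} (hX : LinCols X)
    (v : Fin L' → Bool) (hv : ∃ u, X u v = true) :
    (univ.filter fun u : Fin L → Bool => X u v = true).card = 2 ^ (L - 1) := by
  -- a basis row in the support of the column
  obtain ⟨u₀, hu₀⟩ := hv
  have hex : ∃ i₀ : Fin L, X (basisRow i₀) v = true := by
    by_contra hnone
    have h := apply_eq_sum_basis_of_linCols hX u₀ v
    rw [if_pos hu₀] at h
    have hzero : (∑ i, (if u₀ i = true then (1 : ZMod 2) else 0) *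
        (if X (basisRow i) v = true then (1 : ZMod 2) else 0)) = 0 := by
      refine Finset.sum_eq_zero fun i _ => ?_
      have : X (basisRow i) v ≠ true := fun h => hnone ⟨i, h⟩
      rw [if_neg this, mul_zero]
    rw [hzero] at h
    exact absurd h (by decide)
  obtain ⟨i₀, hi₀⟩ := hex
  have hL : 0 < L := Fin.pos i₀
  -- the flip exchanges ones and zeros
  set S₁ := univ.filter fun u : Fin L → Bool => X u v = true with hS₁
  set S₀ := univ.filter fun u : Fin L → Bool => ¬ X u v = true with hS₀
  have hbij : S₁.card = S₀.card := by
    refine Finset.card_nbij' (CubeChar.flipBit i₀) (CubeChar.flipBit i₀) (fun u hu => ?_)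
      (fun u hu => ?_) (fun u _ => CubeChar.flipBit_flipBit i₀ u)
      (fun u _ => CubeChar.flipBit_flipBit i₀ u)
    · rw [hS₁, Finset.mem_coe, Finset.mem_filter] at hu
      rw [hS₀, Finset.mem_coe, Finset.mem_filter]
      refine ⟨Finset.mem_univ _, fun h => ?_⟩
      exact apply_flipBit_ne hX v hi₀ u (h.trans hu.2.symm)
    · rw [hS₀, Finset.mem_coe, Finset.mem_filter] at hu
      rw [hS₁, Finset.mem_coe, Finset.mem_filter]
      refine ⟨Finset.mem_univ _, ?_⟩
      have hne := apply_flipBit_ne hX v hi₀ u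
      revert hne; have h2 := hu.2; revert h2
      cases X (CubeChar.flipBit i₀ u) v <;> cases X u v <;> simp
  have htot : S₁.card + S₀.card = 2 ^ L := by
    rw [hS₁, hS₀, Finset.card_filter_add_card_filter_not, Finset.card_univ, Fintype.card_fun,
      Fintype.card_bool, Fintype.card_fin]
  have h2 : (2 : ℕ) ^ L = 2 * 2 ^ (L - 1) := by
    rw [← pow_succ']; congr 1; omega
  omega

/-! ### The Hamming weight column by column -/

/-- For linear columns, `hw M = 2^{L−1} · #{v : column v ≠ 0}`. [folklore] -/
theorem hw_eq_of_linCols {M : (Fin L → Bool) → (Fin L' → Bool) → Bool} (hM : LinCols M) :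
    hw M = 2 ^ (L - 1) * (univ.filter fun v : Fin L' → Bool => ∃ u, M u v = true).card := by
  rw [hw_eq_sum_cols]
  have hcol : ∀ v : Fin L' → Bool, (univ.filter fun u : Fin L → Bool => M u v = true).card =
      if (∃ u, M u v = true) then 2 ^ (L - 1) else 0 := by
    intro v
    by_cases hv : ∃ u, M u v = true
    · rw [if_pos hv, card_filter_col_eq_of_linCols hM v hv]
    · rw [if_neg hv, Finset.card_eq_zero, Finset.filter_eq_empty_iff]
      exact fun u _ h => hv ⟨u, h⟩
  simp_rw [hcol]
  rw [Finset.sum_ite, Finset.sum_const_zero, add_zero, Finset.sum_const, smul_eq_mul, mul_comm]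

/-- the columns where `X ⊕ W` is non-zero are the columns where `X` and `W` differ. [folklore] -/
theorem filter_exists_xorM_eq_colDiff (X W : (Fin L → Bool) → (Fin L' → Bool) → Bool) :
    (univ.filter fun v : Fin L' → Bool => ∃ u, xorM X W u v = true) = colDiff X W := by
  unfold colDiff xorM
  refine Finset.filter_congr fun v _ => exists_congr fun u => ?_
  cases X u v <;> cases W u v <;> simp

/-- **The lift-cost identity** (without the superfluous `0 < L`). [folklore] -/
theorem hw_xorM_eq_of_linCols {X W : (Fin L → Bool) → (Fin L' → Bool) → Bool} (hX : LinCols X)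
    (hW : LinCols W) : hw (xorM X W) = 2 ^ (L - 1) * (colDiff X W).card := by
  rw [hw_eq_of_linCols (linCols_xorM hX hW), filter_exists_xorM_eq_colDiff]

/-- **T-a (i) `LiftCostEq`** (qn-p2 Sketch4 §1, verbatim). [folklore] -/
theorem liftCostEq : LiftCostEq := fun _ _ _ _ _ hX hW => hw_xorM_eq_of_linCols hX hW

end Summit.QuantumAdvantage.AdviceFreeQNC0
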